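import Summits.QuantumFields.YangMills.Theorems.UnitScaleGibbsBlockPlaquetteStokesLetters
import HarnessLib

/-!
# Non-abelian lattice Stokes to FIRST ORDER with an explicit SECOND-ORDER remainder, for the translated `a × b` (⊇ `L × L`) square
# (brick (b′) of the S_lin stub of the crux idea «gross-sd-transfer» — LINE 28 candidate on `UnitScaleTilt.HistoryTailL`, stmt-QuantumFields-19936 —
# `Cruxes/HistoryTailL/Ideas/gross-sd-transfer.md` + `GrossTransferAnnex1.md` §2 (iv); ideator ym-r3-idea-2 g15's word «px10: GO (b′)» 2026-08-29T16:31:51Z)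

T. Bałaban, *Averaging operations for lattice gauge theories*, Commun. Math. Phys. **98** (1985) 17–51 [Balaban1985Averaging], (9) p. 18, (19) p. 21 (the non-abelian
Stokes INEQUALITY `|U(∂R) − 1| ≤ Σ |U(∂p) − 1|` — tree ✓ `B10Eq47AxialChi.dist1_rect_le`), and Prop. 3 (124) p. 36: *«The first term on the right-hand side above is
the main term in this linear form … The remaining terms are small»*; T. Bałaban, *Renormalization group approach to lattice gauge field theories. I*, Commun. Math.
Phys. **109** (1987) 249–301 [Balaban1987RG1], (0.3)–(0.4) pp. 252–253 (the symmetric block averaging whose coarse plaquette is the straight `L × L` square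
`rect U (emb p′₋) μ ν L L` of ✓ `BlockAveragingEMLProp2.plaqHol_avgFun_eq_five` ∕ ✓ `B10Eq47AxialChi.plaqHol_axialAvg_eq_rect`, and whose (0.4) loop variables carry the
TRANSLATED squares `rect U (walkEnd (emb y) (stairWord σ n)) μ ν L L` of ✓ `BlockAveragingEMLProp2.prod_four_loopHol_eq`).

WHAT THIS FILE PROVES (kernel; 0 `def`, 0 `sorry`; `SU(N) ⊂ M_N(ℂ)` with the tree's `L²`-operator norm; any `Params`, level `j`, corner `x : Site P j`, sides `a b`;
plaquette `p_{s,t}` = corner `x + t e_ν + s e_μ`, as in ✓ `dist1_rect_le`; letters from `UnitScaleGibbsBlockPlaquetteStokesLetters`):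
* ★★ `norm_rect_one_sub_one_sub_sum_le` (strip) and ★★★ `norm_rect_sub_one_sub_sum_conj_plaq_le`: if `dist₁(U(∂p_{s,t})) ≤ δ` on the tile,
  `‖U(∂R_{a,b}) − 1 − Σ_{t<b} Σ_{s<a} T_{s,t}·(U(∂p_{s,t}) − 1)·T_{s,t}*‖ ≤ (1 + δ)^{ab} − 1 − ab·δ`, `T_{s,t} = rowProd U x ν t · rowProd U (x + t e_ν) μ s` — the
  coarse ∕ translated square variable IS, to first order, the transported sum of its `ab` plaquette variables (print's «main term»), with a second-order remainder;
* ★★ `…_le_sq`: the remainder is `≤ (ab·δ)²` once `ab·δ ≤ 1`; ★★ `…_of_plaqSmall`: under `PlaqSmall δ U` at every corner (the translated squares included);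
* ★★ `norm_plaqHol_axialAvg_sub_one_sub_sum_le_sq`: the `L × L` instance at the coarse plaquette of the axial average (standing range `j + 1 ≤ m + K`), remainder
  `(L²δ)²` — the ideator's «`U(∂(p′)_x) − 1 = Σ_{q ⊂ face} Ad(transport)(U(∂q) − 1) + O((ℓ²a)²)`» with room (`ℓ = (d+2)L ≥ L`).
NEIGHBOUR (not restated, not proved here): ★w2-19936 g14's (M1) `BlockPlaquetteOneStepLinearisation` keeps the translated square `rect U · μ ν L L` SYMBOLIC in the
one-step expansion of `Ū(∂p′)`; this file expands exactly that token.

HONEST SCOPE.  Lattice kinematics of ONE configuration (no measure, no expectation); a GO'd brick of the stub S_lin of an UNREGISTERED crux idea; it proves no stub,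
no «ShallowFluxSecondMomentL» ∕ «BlockSecondMomentL», nothing of (Q) ∕ `MeanDeviationL` ∕ K1 ∕ `HistoryTailL`; rung R3 (YM₃ on T³) is NOT d = 4, NOT infinite volume,
NOT a mass gap, NOT Clay; the Yang–Mills mass gap is NOT proved.  Width seat ym3-torus-px10 g7; `--supports stmt-QuantumFields-19936 --as helper`.
-/

set_option autoImplicit false

open scoped BigOperators

namespace Summit.QuantumFields.YangMills.Theorems.UnitScaleGibbsBlockPlaquetteStokesLinearisation

open Literature.MathematicalPhysics.QuantumFieldTheory.Balaban1983to89
open Literature.MathematicalPhysics.QuantumFieldTheory.Balaban1983to89.B10Eq47AxialChi (shiftN rowProd rect shiftN_succ rowProd_succ)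
open Literature.MathematicalPhysics.QuantumFieldTheory.Balaban1983to89.AveragingRT (axialAvg)
open Summit.QuantumFields.YangMills.Theorems.UnitScaleGibbsBlockPlaquetteStokesLetters
open Summit.QuantumFields.YangMills.Theorems.Prop7HolRatioPerStep (norm_coe_eq_one norm_star_coe_eq_one coe_mul_star_self)

variable {P : Params} {j : ℕ}

/-! ## §4 The first-order Stokes expansion with second-order remainder on `SU(N)` -/

section Main

open scoped Matrix.Norms.L2Operator

variable {n : Type*} [Fintype n] [DecidableEq n] [Nonempty n]

/-- ★★ **STRIP, FIRST ORDER WITH REMAINDER.**  If the `a` plaquette variables `U(∂p_s)` (`p_s` at `x + s e_μ`) are within `δ` of `1`, then for the `a × 1` strip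
`‖U(∂R_{a,1}) − 1‖ ≤ (1+δ)^a − 1` and `‖U(∂R_{a,1}) − 1 − Σ_{s<a} g_s·(U(∂p_s) − 1)·g_s*‖ ≤ (1+δ)^a − 1 − a·δ`, `g_s = rowProd U x μ s`.
[cite: Balaban1985Averaging, (19) p.21 and (124) p.36] -/
theorem norm_rect_one_sub_one_sub_sum_le (U : GaugeField P j (Matrix.specialUnitaryGroup n ℂ)) (x : Site P j)
    {μ ν : Fin P.d} (h : μ < ν) (a : ℕ) {δ : ℝ} (hδ : 0 ≤ δ)
    (hU : ∀ s, s < a → dist1 (GaugeField.plaqHol U ⟨shiftN x μ s, μ, ν, h⟩) ≤ δ) :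
    ‖((rect U x μ ν a 1 : Matrix.specialUnitaryGroup n ℂ) : Matrix n n ℂ) - 1‖ ≤ (1 + δ) ^ a - 1 ∧
    ‖((rect U x μ ν a 1 : Matrix.specialUnitaryGroup n ℂ) : Matrix n n ℂ) - 1 -
        ∑ s ∈ Finset.range a,
          ((rowProd U x μ s : Matrix.specialUnitaryGroup n ℂ) : Matrix n n ℂ) *
            (((GaugeField.plaqHol U ⟨shiftN x μ s, μ, ν, h⟩ : Matrix.specialUnitaryGroup n ℂ) : Matrix n n ℂ) - 1) *
            star ((rowProd U x μ s : Matrix.specialUnitaryGroup n ℂ) : Matrix n n ℂ)‖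
      ≤ (1 + δ) ^ a - 1 - a * δ := by
  -- `g Q g⁻¹ − 1 = g (Q − 1) g*` (the statement of ✓ `Prop7CovariantCoercivity.coe_conj_sub_one`, two lines here)
  have coe_conj_sub_one : ∀ g Q : Matrix.specialUnitaryGroup n ℂ,
      ((g * Q * g⁻¹ : Matrix.specialUnitaryGroup n ℂ) : Matrix n n ℂ) - 1 = (g : Matrix n n ℂ) * ((Q : Matrix n n ℂ) - 1) * star (g : Matrix n n ℂ) :=
    fun g Q => by
      rw [Submonoid.coe_mul, Submonoid.coe_mul, show ((g⁻¹ : Matrix.specialUnitaryGroup n ℂ) : Matrix n n ℂ) = star (g : Matrix n n ℂ) from rfl,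
        mul_sub, sub_mul, mul_one, coe_mul_star_self]
  -- the factors of the exact product and their coercions
  set C : ℕ → Matrix.specialUnitaryGroup n ℂ := fun s =>
    rowProd U x μ s * GaugeField.plaqHol U ⟨shiftN x μ s, μ, ν, h⟩ * (rowProd U x μ s)⁻¹ with hC
  set l : List (Matrix n n ℂ) := ((List.range a).reverse.map C).map
    fun g : Matrix.specialUnitaryGroup n ℂ => (g : Matrix n n ℂ) with hl
  have hrect : ((rect U x μ ν a 1 : Matrix.specialUnitaryGroup n ℂ) : Matrix n n ℂ) = l.prod := by
    rw [rect_one_eq_prod U x h a, coe_list_prod]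
  have hlen : l.length = a := by simp [hl]
  have hnear : ∀ y ∈ l, ‖y - 1‖ ≤ δ := by
    intro y hy
    simp only [hl, List.map_map, List.mem_map, List.mem_reverse, List.mem_range, Function.comp_apply] at hy
    obtain ⟨s, hs, rfl⟩ := hy
    rw [← FederbushMean.dist1_SU_eq, hC]
    simp only
    rw [GaugeGroup.dist1_conj]
    exact hU s hs
  refine ⟨?_, ?_⟩
  · have h0 := norm_list_prod_sub_one_le hδ l hnear
    rwa [hlen, ← hrect] at h0
  · have h1 := norm_list_prod_sub_one_sub_sum_le hδ l hnear
    rw [hlen, ← hrect] at h1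
    -- identify the linear term
    have hsum : (l.map fun y => y - 1).sum =
        ∑ s ∈ Finset.range a,
          ((rowProd U x μ s : Matrix.specialUnitaryGroup n ℂ) : Matrix n n ℂ) *
            (((GaugeField.plaqHol U ⟨shiftN x μ s, μ, ν, h⟩ : Matrix.specialUnitaryGroup n ℂ) : Matrix n n ℂ) - 1) *
            star ((rowProd U x μ s : Matrix.specialUnitaryGroup n ℂ) : Matrix n n ℂ) := by
      rw [hl, List.map_map, List.map_map, List.map_reverse, List.sum_reverse, ← sum_map_range_eq_sum_range]
      congr 1
      refine List.map_congr_left fun s _ => ?_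
      simp only [Function.comp_apply, hC]
      exact coe_conj_sub_one _ _
    rwa [hsum] at h1

/-- ★★★ **RECTANGLE, FIRST ORDER WITH SECOND-ORDER REMAINDER — NON-ABELIAN STOKES LINEARISED.**  If the `ab` plaquette variables `U(∂p_{s,t})` of the tile
(`p_{s,t}` at `x + t e_ν + s e_μ`) are within `δ` of `1`, then the boundary holonomy of the `a × b` rectangle satisfies
`‖U(∂R_{a,b}) − 1 − Σ_{t<b} Σ_{s<a} T_{s,t}·(U(∂p_{s,t}) − 1)·T_{s,t}*‖ ≤ (1 + δ)^{ab} − 1 − ab·δ` with the EXPLICIT transports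
`T_{s,t} = rowProd U x ν t · rowProd U (x + t e_ν) μ s` (up the `ν`-side, then along the row) — the translated square IS, to first order, the transported sum of its
plaquette variables (print's «main term» (124)), with a remainder of second order in `ab·δ`. [cite: Balaban1985Averaging, (19) p.21 and (124) p.36] -/
theorem norm_rect_sub_one_sub_sum_conj_plaq_le (U : GaugeField P j (Matrix.specialUnitaryGroup n ℂ)) (x : Site P j)
    {μ ν : Fin P.d} (h : μ < ν) (a b : ℕ) {δ : ℝ} (hδ : 0 ≤ δ)
    (hU : ∀ t, t < b → ∀ s, s < a → dist1 (GaugeField.plaqHol U ⟨shiftN (shiftN x ν t) μ s, μ, ν, h⟩) ≤ δ) :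
    ‖((rect U x μ ν a b : Matrix.specialUnitaryGroup n ℂ) : Matrix n n ℂ) - 1 -
        ∑ t ∈ Finset.range b, ∑ s ∈ Finset.range a,
          ((rowProd U x ν t * rowProd U (shiftN x ν t) μ s : Matrix.specialUnitaryGroup n ℂ) : Matrix n n ℂ) *
            (((GaugeField.plaqHol U ⟨shiftN (shiftN x ν t) μ s, μ, ν, h⟩ : Matrix.specialUnitaryGroup n ℂ) : Matrix n n ℂ) - 1) *
            star ((rowProd U x ν t * rowProd U (shiftN x ν t) μ s : Matrix.specialUnitaryGroup n ℂ) : Matrix n n ℂ)‖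
      ≤ (1 + δ) ^ (a * b) - 1 - (a * b : ℕ) * δ := by
  -- `g Q g⁻¹ − 1 = g (Q − 1) g*` (the statement of ✓ `Prop7CovariantCoercivity.coe_conj_sub_one`, two lines here)
  have coe_conj_sub_one : ∀ g Q : Matrix.specialUnitaryGroup n ℂ,
      ((g * Q * g⁻¹ : Matrix.specialUnitaryGroup n ℂ) : Matrix n n ℂ) - 1 = (g : Matrix n n ℂ) * ((Q : Matrix n n ℂ) - 1) * star (g : Matrix n n ℂ) :=
    fun g Q => by
      rw [Submonoid.coe_mul, Submonoid.coe_mul, show ((g⁻¹ : Matrix.specialUnitaryGroup n ℂ) : Matrix n n ℂ) = star (g : Matrix n n ℂ) from rfl,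
        mul_sub, sub_mul, mul_one, coe_mul_star_self]
  -- unitary conjugation does not increase the operator norm (the statement of ✓ `Prop7CovIterLambdaBound.norm_conj_su_le`, three lines here)
  have norm_conj_le : ∀ (g : Matrix.specialUnitaryGroup n ℂ) (Z : Matrix n n ℂ),
      ‖(g : Matrix n n ℂ) * Z * star (g : Matrix n n ℂ)‖ ≤ ‖Z‖ := fun g Z =>
    calc ‖(g : Matrix n n ℂ) * Z * star (g : Matrix n n ℂ)‖ ≤ ‖(g : Matrix n n ℂ)‖ * ‖Z‖ * ‖star (g : Matrix n n ℂ)‖ :=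
          (norm_mul_le _ _).trans (mul_le_mul_of_nonneg_right (norm_mul_le _ _) (norm_nonneg _))
      _ = ‖Z‖ := by rw [norm_coe_eq_one, norm_star_coe_eq_one]; ring
  -- letters: strips `S t`, side transports `H t`, factors `X t`, linear parts `Y t`
  set S : ℕ → Matrix.specialUnitaryGroup n ℂ := fun t => rect U (shiftN x ν t) μ ν a 1 with hS
  set H : ℕ → Matrix.specialUnitaryGroup n ℂ := fun t => rowProd U x ν t with hH
  set X : ℕ → Matrix n n ℂ := fun t => ((H t * S t * (H t)⁻¹ : Matrix.specialUnitaryGroup n ℂ) : Matrix n n ℂ) with hX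
  set Λ : ℕ → Matrix n n ℂ := fun t =>
    ∑ s ∈ Finset.range a,
      ((rowProd U (shiftN x ν t) μ s : Matrix.specialUnitaryGroup n ℂ) : Matrix n n ℂ) *
        (((GaugeField.plaqHol U ⟨shiftN (shiftN x ν t) μ s, μ, ν, h⟩ : Matrix.specialUnitaryGroup n ℂ) : Matrix n n ℂ) - 1) *
        star ((rowProd U (shiftN x ν t) μ s : Matrix.specialUnitaryGroup n ℂ) : Matrix n n ℂ) with hΛ
  set Y : ℕ → Matrix n n ℂ := fun t => ((H t : Matrix.specialUnitaryGroup n ℂ) : Matrix n n ℂ) * Λ t *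
    star ((H t : Matrix.specialUnitaryGroup n ℂ) : Matrix n n ℂ) with hY
  set ε : ℝ := (1 + δ) ^ a - 1 with hε
  set ρ : ℝ := (1 + δ) ^ a - 1 - a * δ with hρ
  have hε0 : 0 ≤ ε := by
    have : (1 : ℝ) ≤ (1 + δ) ^ a := one_le_pow₀ (by linarith)
    rw [hε]; linarith
  -- the strip estimates at every height
  have hstrip : ∀ t, t < b →
      ‖((S t : Matrix.specialUnitaryGroup n ℂ) : Matrix n n ℂ) - 1‖ ≤ ε ∧
      ‖((S t : Matrix.specialUnitaryGroup n ℂ) : Matrix n n ℂ) - 1 - Λ t‖ ≤ ρ := fun t ht =>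
    norm_rect_one_sub_one_sub_sum_le U (shiftN x ν t) h a hδ (fun s hs => hU t ht s hs)
  -- the exact product
  have hrect : ((rect U x μ ν a b : Matrix.specialUnitaryGroup n ℂ) : Matrix n n ℂ) = ((List.range b).map X).prod := by
    rw [rect_eq_prod_strips U x μ ν a b, coe_list_prod, List.map_map]
    rfl
  -- the outer layer, restricted to the heights `t < b` actually present (hypotheses are only available there)
  have hXt : ∀ t, t < b → ‖X t - 1‖ ≤ ε := by
    intro t ht
    rw [hX]; simp only
    rw [coe_conj_sub_one]
    exact (norm_conj_le _ _).trans (hstrip t ht).1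
  have hYt : ∀ t, t < b → ‖X t - 1 - Y t‖ ≤ ρ := by
    intro t ht
    rw [hX, hY]; simp only
    rw [coe_conj_sub_one, ← sub_mul, ← mul_sub]
    exact (norm_conj_le _ _).trans (hstrip t ht).2
  -- make the factors total in `t` (beyond `t < b` nothing is claimed): `X' = 1`, `Y' = 0` there
  have hρ0 : 0 ≤ ρ := by
    have hb : 1 + (a : ℝ) * δ ≤ (1 + δ) ^ a := one_add_mul_le_pow (by linarith) a
    rw [hρ]; linarith
  set X' : ℕ → Matrix n n ℂ := fun t => if t < b then X t else 1 with hX'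
  set Y' : ℕ → Matrix n n ℂ := fun t => if t < b then Y t else 0 with hY'
  have hXt' : ∀ t, ‖X' t - 1‖ ≤ ε := by
    intro t
    by_cases ht : t < b
    · rw [hX']; simp only [ht, ↓reduceIte]; exact hXt t ht
    · rw [hX']; simp only [ht, ↓reduceIte, sub_self, norm_zero]; exact hε0
  have hYt' : ∀ t, ‖X' t - 1 - Y' t‖ ≤ ρ := by
    intro t
    by_cases ht : t < b
    · rw [hX', hY']; simp only [ht, ↓reduceIte]; exact hYt t ht
    · rw [hX', hY']; simp only [ht, ↓reduceIte, sub_self, norm_zero]; exact hρ0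
  have hmain := norm_list_prod_sub_one_sub_sum_le₂ hε0 X' Y' hXt' hYt' (List.range b)
  have e1 : (List.range b).map X' = (List.range b).map X :=
    List.map_congr_left fun t ht => by rw [hX']; simp only [List.mem_range.1 ht, ↓reduceIte]
  have e2 : (List.range b).map Y' = (List.range b).map Y :=
    List.map_congr_left fun t ht => by rw [hY']; simp only [List.mem_range.1 ht, ↓reduceIte]
  rw [e1, e2, List.length_range, ← hrect, sum_map_range_eq_sum_range] at hmain
  -- identify the linear term
  have hlin : ∑ t ∈ Finset.range b, Y t =
      ∑ t ∈ Finset.range b, ∑ s ∈ Finset.range a,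
        ((rowProd U x ν t * rowProd U (shiftN x ν t) μ s : Matrix.specialUnitaryGroup n ℂ) : Matrix n n ℂ) *
          (((GaugeField.plaqHol U ⟨shiftN (shiftN x ν t) μ s, μ, ν, h⟩ : Matrix.specialUnitaryGroup n ℂ) : Matrix n n ℂ) - 1) *
          star ((rowProd U x ν t * rowProd U (shiftN x ν t) μ s : Matrix.specialUnitaryGroup n ℂ) : Matrix n n ℂ) := by
    refine Finset.sum_congr rfl fun t _ => ?_
    rw [hY, hΛ, hH]; simp only
    rw [Finset.mul_sum, Finset.sum_mul]
    refine Finset.sum_congr rfl fun s _ => ?_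
    rw [Submonoid.coe_mul, star_mul]
    noncomm_ring
  rw [hlin] at hmain
  -- the arithmetic of the two radii: `(1+ε)^b − 1 − bε + bρ = (1+δ)^{ab} − 1 − abδ`
  have harith : (1 + ε) ^ b - 1 - (b : ℝ) * ε + (b : ℝ) * ρ = (1 + δ) ^ (a * b) - 1 - ((a * b : ℕ) : ℝ) * δ := by
    rw [hε, hρ, add_sub_cancel, ← pow_mul]
    push_cast
    ring
  rw [harith] at hmain
  exact hmain

/-- ★★ **THE FRIENDLY FORM**: under the same hypotheses and `ab·δ ≤ 1`, the second-order remainder is at most `(ab·δ)²`.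
[cite: Balaban1985Averaging, (19) p.21 and (124) p.36] -/
theorem norm_rect_sub_one_sub_sum_conj_plaq_le_sq (U : GaugeField P j (Matrix.specialUnitaryGroup n ℂ)) (x : Site P j)
    {μ ν : Fin P.d} (h : μ < ν) (a b : ℕ) {δ : ℝ} (hδ : 0 ≤ δ) (hab : ((a * b : ℕ) : ℝ) * δ ≤ 1)
    (hU : ∀ t, t < b → ∀ s, s < a → dist1 (GaugeField.plaqHol U ⟨shiftN (shiftN x ν t) μ s, μ, ν, h⟩) ≤ δ) :
    ‖((rect U x μ ν a b : Matrix.specialUnitaryGroup n ℂ) : Matrix n n ℂ) - 1 -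
        ∑ t ∈ Finset.range b, ∑ s ∈ Finset.range a,
          ((rowProd U x ν t * rowProd U (shiftN x ν t) μ s : Matrix.specialUnitaryGroup n ℂ) : Matrix n n ℂ) *
            (((GaugeField.plaqHol U ⟨shiftN (shiftN x ν t) μ s, μ, ν, h⟩ : Matrix.specialUnitaryGroup n ℂ) : Matrix n n ℂ) - 1) *
            star ((rowProd U x ν t * rowProd U (shiftN x ν t) μ s : Matrix.specialUnitaryGroup n ℂ) : Matrix n n ℂ)‖
      ≤ (((a * b : ℕ) : ℝ) * δ) ^ 2 :=
  (norm_rect_sub_one_sub_sum_conj_plaq_le U x h a b hδ hU).trans (one_add_pow_sub_one_sub_mul_le_sq hδ (a * b) hab)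

/-- ★★ **UNDER `PlaqSmall δ U`, AT EVERY CORNER** (the translated squares of ✓ `BlockAveragingEMLProp2.prod_four_loopHol_eq` included): the first-order Stokes
expansion of every `a × b` rectangle holonomy with remainder `(1+δ)^{ab} − 1 − ab·δ`. [cite: Balaban1985Averaging, (19) p.21 and (124) p.36] -/
theorem norm_rect_sub_one_sub_sum_conj_plaq_le_of_plaqSmall {δ : ℝ} (hδ : 0 ≤ δ)
    {U : GaugeField P j (Matrix.specialUnitaryGroup n ℂ)} (hU : PlaqSmall δ U) (x : Site P j) {μ ν : Fin P.d} (h : μ < ν) (a b : ℕ) :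
    ‖((rect U x μ ν a b : Matrix.specialUnitaryGroup n ℂ) : Matrix n n ℂ) - 1 -
        ∑ t ∈ Finset.range b, ∑ s ∈ Finset.range a,
          ((rowProd U x ν t * rowProd U (shiftN x ν t) μ s : Matrix.specialUnitaryGroup n ℂ) : Matrix n n ℂ) *
            (((GaugeField.plaqHol U ⟨shiftN (shiftN x ν t) μ s, μ, ν, h⟩ : Matrix.specialUnitaryGroup n ℂ) : Matrix n n ℂ) - 1) *
            star ((rowProd U x ν t * rowProd U (shiftN x ν t) μ s : Matrix.specialUnitaryGroup n ℂ) : Matrix n n ℂ)‖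
      ≤ (1 + δ) ^ (a * b) - 1 - (a * b : ℕ) * δ :=
  norm_rect_sub_one_sub_sum_conj_plaq_le U x h a b hδ fun _ _ _ _ => (hU _).le

/-- ★★ **THE `L × L` INSTANCE AT THE COARSE PLAQUETTE OF THE AXIAL AVERAGE** (standing range `j + 1 ≤ m + K`; `Ū(∂p′) = rect U (emb p′₋) μ ν L L` by
✓ `B10Eq47AxialChi.plaqHol_axialAvg_eq_rect`): under `PlaqSmall δ U` and `L²·δ ≤ 1`,
`‖Ū(∂p′) − 1 − Σ_{t<L} Σ_{s<L} T_{s,t}·(U(∂p_{s,t}) − 1)·T_{s,t}*‖ ≤ (L²δ)²` — the coarse plaquette variable is the transported sum of its `L²` fine plaquette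
variables up to second order (print's «main term» (124) for the straight square; the (0.4) ∕ `exp[mean log]` corrections are ★w2-19936 g14's (M1)).
[cite: Balaban1985Averaging, (9)–(10) pp.18–19, (19) p.21 and (124) p.36] -/
theorem norm_plaqHol_axialAvg_sub_one_sub_sum_le_sq (hj : j + 1 ≤ P.m + P.K) {δ : ℝ} (hδ : 0 ≤ δ)
    (hL : (((P.L * P.L : ℕ) : ℝ)) * δ ≤ 1)
    {U : GaugeField P j (Matrix.specialUnitaryGroup n ℂ)} (hU : PlaqSmall δ U) (p : Plaq P (j + 1)) :
    ‖((GaugeField.plaqHol (axialAvg U) p : Matrix.specialUnitaryGroup n ℂ) : Matrix n n ℂ) - 1 -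
        ∑ t ∈ Finset.range P.L, ∑ s ∈ Finset.range P.L,
          ((rowProd U (emb p.src) p.ν t * rowProd U (shiftN (emb p.src) p.ν t) p.μ s : Matrix.specialUnitaryGroup n ℂ) : Matrix n n ℂ) *
            (((GaugeField.plaqHol U ⟨shiftN (shiftN (emb p.src) p.ν t) p.μ s, p.μ, p.ν, p.hμν⟩ : Matrix.specialUnitaryGroup n ℂ) :
              Matrix n n ℂ) - 1) *
            star ((rowProd U (emb p.src) p.ν t * rowProd U (shiftN (emb p.src) p.ν t) p.μ s : Matrix.specialUnitaryGroup n ℂ) :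
              Matrix n n ℂ)‖
      ≤ ((((P.L * P.L : ℕ) : ℝ)) * δ) ^ 2 := by
  rw [B10Eq47AxialChi.plaqHol_axialAvg_eq_rect hj]
  exact norm_rect_sub_one_sub_sum_conj_plaq_le_sq U (emb p.src) p.hμν P.L P.L hδ hL fun _ _ _ _ => (hU _).le

end Main

end Summit.QuantumFields.YangMills.Theorems.UnitScaleGibbsBlockPlaquetteStokesLinearisation
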